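import Literature.AnabelianGeometry.EtaleTheta.LogDivisorModelTateTowerKummer
import Literature.AnabelianGeometry.EtaleTheta.SettingModelSemidirectTopology
import Mathlib.Topology.Instances.ZMod

/-!
# [EtTh] Def. 3.3 (i)(c)/(ii) v2: the ζ-TWISTED Kummer–Tate group `(K ⋊_χ C) × ℤ_γ` and its `LevelSystem`

S. Mochizuki, *The étale theta function …*, Publ. RIMS **45** (2009) [MochizukiEtTh2009], §1 p.13 («`K_N := K(ζ_N,
q_X^{1/N})`»: the constant field acts on `N`-th roots through the cyclotomic character), §3 Def. 3.3 (i)(c) p.72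
(`Δ^{fil,∞}_i`), (ii) p.73 (`Δ^fil`-closures, the level of a connected tempered covering) [cite: MochizukiEtTh2009, Def 3.3 (ii) p.73].

CLASS (b) DESIGN MODEL (abc-iut cell, layer L2, row R677/R689 «ζ-TWISTED KUMMER ACTION ON THE TATE TOWER»,
abc-iut-L2-lead gen 5; seat abc-iut-L1-t6 g4), piece (b)+(c) of the row: the GROUP and the LEVEL STRUCTURE.
abc-iut-w6-d058's Kummer–Tate group `TateTowerKummer.Grp = ℤ_γ × ℤ^ℕ` (`LogDivisorModelTateTowerKummer.lean`) is
ABELIAN and «no roots of unity are recorded»; here the Kummer coordinates are the level-wise cyclotomic modules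
`K := ∏_n (ℤ/M_n)²`, `M_n = (n+2)!` (two Kummer classes per level: the roots of `ϖ` and of `U` on `Z_∞^{(n)}`), a CONSTANT-FIELD factor
`C := ∏_n (ℤ/M_n)ˣ` acts on `K` through the level-wise CYCLOTOMIC CHARACTER `χ_n : C → (ℤ/M_n)ˣ` (multiplication;
`act`, `act_apply`), and the group of the tower is the NON-ABELIAN topological group
**`Grp := (K ⋊_χ C) × ℤ_γ`** (`K`, `C` profinite = products of finite discrete groups; the semidirect factor
topologised along `g ↦ (g.left, g.right)` — abc-iut-w5-d249's `Semidirect.isTopologicalGroup_of_continuous_action`;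
`ℤ_γ` discrete).  Over it, Def. 3.3 (i)(c)/(ii) exactly as in the abelian file, with the commutativity argument
replaced by NORMALITY: `closure n = Δ_n := {γ = 1, c = 1, Kummer coordinates of level < n trivial}` is a normal
subgroup (`closure_normal`: `h (k,1,1) h⁻¹ = (χ(h_C)·k, 1, 1)` and `χ` acts coordinatewise), nested
(`closure_antitone`, strictly: `le_of_closure_le`), every open neighbourhood of `1` contains some `Δ_n`
(`exists_closure_subset_of_isOpen`), hence every connected tempered `Grp`-set `Y` has a level
`lvl Y := sInf {n | Δ_n fixes Y}` (stabilisers in one orbit are CONJUGATE, `Δ_n ⊴ Grp`), monotone along covering maps: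
**`levels : LevelSystem Grp`, both laws PROVED.** The compatible («genuinely `Ẑ(1)² ⋊ Ẑˣ`») part is the closed subgroup
cut out level-wise by the transition maps `ZMod.castHom`; it is not needed for the level structure and is left to the
tower file.
HANDOFF SPEC for pieces (a)+(d) (tower lineage): (a) a per-level `LogDivisorModel` `Z n` = the Tate skeleton with
torsion constants, `Fn_n := μ_{n!} × ⟨ϖ^{1/n!}⟩ × ⟨U^{1/n!}⟩` (divisor trivial on `μ`, Def. 3.1 cusp laws as in
`LogDivisorModelTateTower.lean`), `Grp` acting by `γ` = translation of the chain, `(k, c) · U^{1/n!} = ζ_{n!}^{k_n.2} U^{1/n!}`,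
`c · ζ = ζ^{χ_n(c)}`; (d) `LogDivisorTower Grp levels` with transitions `x ↦ x^{m!/n!}` (`TateTowerKummer.e`),
`act_closure_fn/div` from `mem_closure_iff`, then the `RootLaw` / `isTempered` sequels as for w6-d058's tower.
HONEST LABEL: a combinatorial design model for the v2 interface, NOT the tempered fundamental group of a Tate curve;
instances only on the NEW carriers `KC`/`Grp`; nothing here bears on [IUTchIII] Cor. 3.12; no side taken; typed ≠ proved.
-/

noncomputable section

namespace Literature.AnabelianGeometry.EtaleTheta

open CategoryTheory Function Literature.AlgebraicGeometry.Frobenioids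
  Literature.AlgebraicGeometry.Frobenioids.QuasiTemperoid Literature.AnabelianGeometry.SemiGraphs

namespace TateTowerKummerTwist

/-! ## The Kummer module, the constant-field factor and the cyclotomic action -/

/-- The modulus of level `n`: `M n = (n+2)!` (the tower `… → Z_∞^{(n)} → …` adjoins `M n`-th roots; the shift by
`2` only discards the two trivial levels `0! = 1! = 1`, so that the level subgroups are pairwise distinct).
[cite: MochizukiEtTh2009, Def 3.3 (ii) p.73] -/
abbrev M (n : ℕ) : ℕ := (n + 2).factorial

/-- `M n ≥ 2`, so `ℤ/M n` is non-trivial (levels are pairwise distinct). [cite: MochizukiEtTh2009, Def 3.3 (ii) p.73] -/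
theorem one_lt_M (n : ℕ) : 1 < M n :=
  lt_of_lt_of_le (by decide) (Nat.factorial_le (Nat.le_add_left 2 n))

/-- The additive Kummer coordinates: at level `n` the two Kummer classes (roots of `ϖ`, of `U`) modulo `M n = (n+2)!`.
[cite: MochizukiEtTh2009, Def 3.3 (ii) p.73] -/
abbrev KumAdd : Type := ∀ n : ℕ, ZMod (M n) × ZMod (M n)

/-- The Kummer factor `K = ∏_n (ℤ/M_n)²`, written multiplicatively. [cite: MochizukiEtTh2009, Def 3.3 (ii) p.73] -/
abbrev Kum : Type := Multiplicative KumAdd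

/-- The constant-field factor `C = ∏_n (ℤ/M_n)ˣ` (level-wise values of the cyclotomic character).
[cite: MochizukiEtTh2009, §1 p.13] -/
abbrev Cst : Type := ∀ n : ℕ, (ZMod (M n))ˣ

/-- The level-wise cyclotomic action of `c ∈ C` on the Kummer coordinates: multiplication by `χ_n(c) = c_n` at
level `n`, as an additive automorphism. [cite: MochizukiEtTh2009, §1 p.13] -/
def actAdd (c : Cst) : KumAdd ≃+ KumAdd where
  toFun k n := c n • k n
  invFun k n := (c n)⁻¹ • k n
  left_inv k := funext fun n => inv_smul_smul (c n) (k n)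
  right_inv k := funext fun n => smul_inv_smul (c n) (k n)
  map_add' k k' := funext fun n => smul_add (c n) (k n) (k' n)

/-- `actAdd` on a coordinate. [cite: MochizukiEtTh2009, §1 p.13] -/
@[simp] theorem actAdd_apply (c : Cst) (k : KumAdd) (n : ℕ) : actAdd c k n = c n • k n := rfl

/-- **The cyclotomic character as an action `χ : C →* Aut(K)`** (`c ↦` multiplication by `c_n` at level `n`).
[cite: MochizukiEtTh2009, §1 p.13] -/
def act : Cst →* MulAut Kum where
  toFun c := AddEquiv.toMultiplicative (actAdd c)
  map_one' := MulEquiv.ext fun k =>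
    show Multiplicative.ofAdd (fun n => (1 : Cst) n • k.toAdd n) = k from
      (congrArg Multiplicative.ofAdd (funext fun n => one_smul _ (k.toAdd n))).trans (ofAdd_toAdd k)
  map_mul' c c' := MulEquiv.ext fun k =>
    show Multiplicative.ofAdd (fun n => (c * c') n • k.toAdd n) =
        Multiplicative.ofAdd (fun n => c n • (Multiplicative.ofAdd (fun m => c' m • k.toAdd m)).toAdd n) from
      congrArg Multiplicative.ofAdd (funext fun n => mul_smul (c n) (c' n) (k.toAdd n))

/-- `act` on a coordinate (additively). [cite: MochizukiEtTh2009, §1 p.13] -/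
@[simp] theorem toAdd_act_apply (c : Cst) (k : Kum) (n : ℕ) : (act c k).toAdd n = c n • k.toAdd n := rfl

/-- **The action `(c, k) ↦ χ(c)·k` is jointly continuous** (each output coordinate depends only on one coordinate of
`c` and of `k`, through discrete finite groups). [cite: MochizukiEtTh2009, §1 p.13] -/
theorem continuous_act : Continuous fun q : Cst × Kum => act q.1 q.2 := by
  have h : Continuous fun q : Cst × Kum => fun n => q.1 n • (q.2.toAdd n) := by
    refine continuous_pi fun n => ?_
    have h1 : Continuous fun q : Cst × Kum => (q.1 n, q.2.toAdd n) :=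
      ((continuous_apply n).comp continuous_fst).prodMk
        ((continuous_apply n).comp (continuous_toAdd.comp continuous_snd))
    exact (continuous_of_discreteTopology (f := fun r : (ZMod (M n))ˣ × (ZMod (M n) × ZMod (M n)) =>
      r.1 • r.2)).comp h1
  exact continuous_ofAdd.comp h

/-! ## The group `(K ⋊_χ C) × ℤ_γ` -/

/-- The arithmetic Kummer factor `K ⋊_χ C`. [cite: MochizukiEtTh2009, §1 p.13] -/
abbrev KC : Type := Kum ⋊[act] Cst

/-- The topology of `K ⋊_χ C`: induced along `g ↦ (g.left, g.right) ∈ K × C` (the pattern of the tree's χ-twisted §1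
models). [cite: MochizukiEtTh2009, §1 p.12] -/
instance instTopologicalSpaceKC : TopologicalSpace KC :=
  TopologicalSpace.induced (fun g : KC => (g.left, g.right)) inferInstance

/-- `g ↦ (g.left, g.right)` is inducing (by definition). [cite: MochizukiEtTh2009, §1 p.12] -/
theorem isInducing_leftRight : Topology.IsInducing fun g : KC => (g.left, g.right) := ⟨rfl⟩

/-- **`K ⋊_χ C` is a topological group.** [cite: MochizukiEtTh2009, §1 p.12] -/
instance instIsTopologicalGroupKC : IsTopologicalGroup KC :=
  SettingModel.Semidirect.isTopologicalGroup_of_continuous_action isInducing_leftRight continuous_act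

/-- **The Galois group of the ζ-twisted Kummer–Tate tower**: `(K ⋊_χ C) × ℤ_γ` — Kummer part, constant field acting
through the cyclotomic character, translations of the chain (discrete). [cite: MochizukiEtTh2009, Def 3.3 (ii) p.73] -/
abbrev Grp : Type := KC × Multiplicative ℤ

/-- The Kummer element with coordinates `k`: `((k, 1), 1)`. [cite: MochizukiEtTh2009, Def 3.3 (ii) p.73] -/
def ofKum (k : Kum) : Grp := (SemidirectProduct.inl k, 1)

/-- `ofKum` is continuous. [cite: MochizukiEtTh2009, Def 3.3 (ii) p.73] -/
theorem continuous_ofKum : Continuous ofKum :=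
  (SettingModel.Semidirect.continuous_inl isInducing_leftRight).prodMk continuous_const

/-! ## The level subgroups `Δ_n` -/

/-- **`Δ_n = Δ^{fil,∞}_n`**: trivial translation, trivial constant-field component, and trivial Kummer coordinates at
all levels `< n` (a subgroup of the geometric Kummer part). [cite: MochizukiEtTh2009, Def 3.3 (i) p.72] -/
def closure (n : ℕ) : Subgroup Grp where
  carrier := {g | g.2 = 1 ∧ g.1.right = 1 ∧ ∀ i < n, g.1.left.toAdd i = 0}
  mul_mem' := by
    rintro a b ⟨ha, ha', ha''⟩ ⟨hb, hb', hb''⟩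
    refine ⟨by rw [Prod.snd_mul, ha, hb, mul_one], by rw [Prod.fst_mul, SemidirectProduct.mul_right, ha', hb', mul_one],
      fun i hi => ?_⟩
    rw [Prod.fst_mul, SemidirectProduct.mul_left, ha', map_one, MulAut.one_apply, toAdd_mul, Pi.add_apply,
      ha'' i hi, hb'' i hi, add_zero]
  one_mem' := ⟨rfl, rfl, fun _ _ => rfl⟩
  inv_mem' := by
    rintro a ⟨ha, ha', ha''⟩
    refine ⟨by rw [Prod.snd_inv, ha, inv_one], by rw [Prod.fst_inv, SemidirectProduct.inv_right, ha', inv_one],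
      fun i hi => ?_⟩
    rw [Prod.fst_inv, SemidirectProduct.inv_left, ha', inv_one, map_one, MulAut.one_apply, toAdd_inv, Pi.neg_apply,
      ha'' i hi, neg_zero]

/-- Membership in `Δ_n`. [cite: MochizukiEtTh2009, Def 3.3 (i) p.72] -/
theorem mem_closure_iff (n : ℕ) (g : Grp) :
    g ∈ closure n ↔ g.2 = 1 ∧ g.1.right = 1 ∧ ∀ i < n, g.1.left.toAdd i = 0 := Iff.rfl

/-- An element of `Δ_n` is the Kummer element of its Kummer coordinates. [cite: MochizukiEtTh2009, Def 3.3 (i) p.72] -/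
theorem eq_ofKum_of_mem_closure {n : ℕ} {g : Grp} (hg : g ∈ closure n) : g = ofKum g.1.left := by
  obtain ⟨h2, h1, -⟩ := hg
  refine Prod.ext (SemidirectProduct.ext ?_ ?_) ?_
  · rw [ofKum, SemidirectProduct.left_inl]
  · rw [ofKum, SemidirectProduct.right_inl, h1]
  · rw [ofKum, h2]

/-- Conjugation of a Kummer element: `h · (k,1,1) · h⁻¹ = (χ(h_C)·k, 1, 1)` — the ζ-TWIST.
[cite: MochizukiEtTh2009, §1 p.13] -/
theorem conj_ofKum (h : Grp) (k : Kum) : h * ofKum k * h⁻¹ = ofKum (act h.1.right k) := by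
  refine Prod.ext (SemidirectProduct.ext ?_ ?_) ?_
  · change (h.1 * SemidirectProduct.inl k * h.1⁻¹).left = act h.1.right k
    rw [SemidirectProduct.mul_left, SemidirectProduct.mul_left, SemidirectProduct.mul_right,
      SemidirectProduct.left_inl, SemidirectProduct.right_inl, mul_one, SemidirectProduct.inv_left,
      show act h.1.right (act h.1.right⁻¹ h.1.left⁻¹) = h.1.left⁻¹ by
        rw [← MulAut.mul_apply, ← map_mul, mul_inv_cancel, map_one, MulAut.one_apply],
      mul_inv_cancel_comm]
  · change (h.1 * SemidirectProduct.inl k * h.1⁻¹).right = 1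
    rw [SemidirectProduct.mul_right, SemidirectProduct.mul_right, SemidirectProduct.right_inl, mul_one,
      SemidirectProduct.inv_right, mul_inv_cancel]
  · change h.2 * 1 * h.2⁻¹ = 1
    rw [mul_one, mul_inv_cancel]

/-- The Kummer element `(k,1,1)` lies in `Δ_n` iff the coordinates of `k` at the levels `< n` vanish.
[cite: MochizukiEtTh2009, Def 3.3 (i) p.72] -/
theorem ofKum_mem_closure_iff (n : ℕ) (k : Kum) : ofKum k ∈ closure n ↔ ∀ i < n, k.toAdd i = 0 := by
  rw [mem_closure_iff]
  simp only [ofKum, SemidirectProduct.right_inl, SemidirectProduct.left_inl, true_and]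

/-- **`Δ_n` is NORMAL in `Grp`** (the constant field acts on the Kummer coordinates coordinatewise, the translations
centralise them). [cite: MochizukiEtTh2009, Def 3.3 (i) p.72] -/
theorem closure_normal (n : ℕ) : (closure n).Normal := by
  refine ⟨fun g hg h => ?_⟩
  have hk := (ofKum_mem_closure_iff n g.1.left).1 (eq_ofKum_of_mem_closure hg ▸ hg)
  rw [eq_ofKum_of_mem_closure hg, conj_ofKum, ofKum_mem_closure_iff]
  intro i hi
  rw [toAdd_act_apply, hk i hi, smul_zero]

/-- The `Δ_n` are nested: `Δ_m ⊆ Δ_n` for `n ≤ m`. [cite: MochizukiEtTh2009, Def 3.3 (i) p.72] -/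
theorem closure_antitone {n m : ℕ} (h : n ≤ m) : closure m ≤ closure n :=
  fun _ hg => ⟨hg.1, hg.2.1, fun i hi => hg.2.2 i (lt_of_lt_of_le hi h)⟩

/-- The Kummer generator of level `i` (root of `ϖ`): coordinate `i` equal to `(1, 0)`. [cite: MochizukiEtTh2009, Def 3.3 (ii) p.73] -/
def delta (i : ℕ) : Grp := ofKum (Multiplicative.ofAdd (Pi.single i ((1 : ZMod (M i)), (0 : ZMod (M i)))))

/-- `δ_i ∈ Δ_n` iff `n ≤ i`. [cite: MochizukiEtTh2009, Def 3.3 (i) p.72] -/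
theorem delta_mem_closure_iff (i n : ℕ) : delta i ∈ closure n ↔ n ≤ i := by
  rw [delta, ofKum_mem_closure_iff]
  constructor
  · intro h
    by_contra hlt
    have h1 := congrArg Prod.fst (h i (lt_of_not_ge hlt))
    rw [toAdd_ofAdd, Pi.single_eq_same] at h1
    haveI : Fact (1 < M i) := ⟨one_lt_M i⟩
    exact one_ne_zero h1
  · intro h j hj
    rw [toAdd_ofAdd, Pi.single_eq_of_ne (Nat.ne_of_lt (lt_of_lt_of_le hj h))]

/-- `Δ_j ⊆ Δ_i` forces `i ≤ j`: the level subgroups are pairwise distinct and linearly ordered.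
[cite: MochizukiEtTh2009, Def 3.3 (i) p.72] -/
theorem le_of_closure_le {i j : ℕ} (h : closure j ≤ closure i) : i ≤ j :=
  (delta_mem_closure_iff j i).1 (h ((delta_mem_closure_iff j j).2 le_rfl))

/-- **Every open neighbourhood of `1` in `Grp` contains some `Δ_n`** (the Kummer factor carries the product topology of
finite discrete groups: an open set constrains finitely many coordinates). [cite: MochizukiEtTh2009, Def 3.3 (i) p.72] -/
theorem exists_closure_subset_of_isOpen {U : Set Grp} (hU : IsOpen U) (h1 : (1 : Grp) ∈ U) :
    ∃ n, (closure n : Set Grp) ⊆ U := by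
  let ι : KumAdd → Grp := fun k => ofKum (Multiplicative.ofAdd k)
  have hι : Continuous ι := continuous_ofKum.comp continuous_ofAdd
  have h0 : (0 : KumAdd) ∈ ι ⁻¹' U := by
    change ofKum (Multiplicative.ofAdd 0) ∈ U
    rw [ofAdd_zero, ofKum, map_one]
    exact h1
  obtain ⟨I, w, hw, hIw⟩ := isOpen_pi_iff.1 (hU.preimage hι) 0 h0
  refine ⟨I.sup id + 1, fun g hg => ?_⟩
  have hk := (ofKum_mem_closure_iff _ g.1.left).1 (eq_ofKum_of_mem_closure hg ▸ hg)
  have hmem : g.1.left.toAdd ∈ (I : Set ℕ).pi w := by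
    intro a ha
    have hlt : a < I.sup id + 1 := Nat.lt_succ_of_le (Finset.le_sup (f := id) ha)
    rw [hk a hlt]
    exact (hw a ha).2
  have hU' := hIw hmem
  change ofKum (Multiplicative.ofAdd g.1.left.toAdd) ∈ U at hU'
  rw [ofAdd_toAdd, ← eq_ofKum_of_mem_closure hg] at hU'
  exact hU'

/-! ## The level of a connected tempered covering (non-abelian version: conjugate stabilisers + normality) -/

/-- A point of a tempered `Grp`-set is fixed by some `Δ_n` (its stabiliser is open). [cite: MochizukiEtTh2009, Def 3.3 (ii) p.73] -/
theorem exists_closure_fix (T : BTemp Grp) (y : T.obj.V) : ∃ n, ∀ g ∈ closure n, T.obj.ρ g y = y := by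
  obtain ⟨n, hn⟩ := exists_closure_subset_of_isOpen (T.property.2 y) (BTempConnected.ρ_one_apply T y)
  exact ⟨n, fun g hg => hn hg⟩

/-- For a CONNECTED tempered covering one `Δ_n` fixes every point: the points form one orbit, the stabiliser of
`h · y₀` is the `h`-conjugate of that of `y₀`, and `Δ_n` is normal. [cite: MochizukiEtTh2009, Def 3.3 (ii) p.73] -/
theorem exists_closure_fixes (Y : ConnectedPart (BTemp Grp)) :
    ∃ n, ∀ g ∈ closure n, ∀ y : Y.obj.obj.V, Y.obj.obj.ρ g y = y := by
  obtain ⟨y₀⟩ := BTempConnected.nonempty_of_isConnectedObj Y.obj Y.property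
  obtain ⟨n, hn⟩ := exists_closure_fix Y.obj y₀
  refine ⟨n, fun g hg y => ?_⟩
  obtain ⟨h, rfl⟩ := BTempConnected.exists_ρ_eq_of_isConnectedObj Y.obj Y.property y₀ y
  have hc : h⁻¹ * g * h⁻¹⁻¹ ∈ closure n := (closure_normal n).conj_mem g hg h⁻¹
  rw [inv_inv] at hc
  rw [← BTempConnected.ρ_mul_apply, show g * h = h * (h⁻¹ * g * h) by
      rw [← mul_assoc, ← mul_assoc, mul_inv_cancel, one_mul],
    BTempConnected.ρ_mul_apply, hn _ hc]

/-- **The level of a connected tempered covering `Y`**: the least `n` such that `Δ_n` fixes `Y`.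
[cite: MochizukiEtTh2009, Def 3.3 (ii) p.73] -/
def lvl (Y : ConnectedPart (BTemp Grp)) : ℕ := sInf {n | ∀ g ∈ closure n, ∀ y : Y.obj.obj.V, Y.obj.obj.ρ g y = y}

/-- `Δ_{lvl Y}` fixes `Y`. [cite: MochizukiEtTh2009, Def 3.3 (i) p.72] -/
theorem closure_lvl_fixes (Y : ConnectedPart (BTemp Grp)) :
    ∀ g ∈ closure (lvl Y), ∀ y : Y.obj.obj.V, Y.obj.obj.ρ g y = y :=
  Nat.sInf_mem (s := {n | ∀ g ∈ closure n, ∀ y : Y.obj.obj.V, Y.obj.obj.ρ g y = y}) (exists_closure_fixes Y)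

/-- Minimality of the level. [cite: MochizukiEtTh2009, Def 3.3 (i) p.72] -/
theorem lvl_le {Y : ConnectedPart (BTemp Grp)} {n : ℕ} (h : ∀ g ∈ closure n, ∀ y : Y.obj.obj.V, Y.obj.obj.ρ g y = y) :
    lvl Y ≤ n :=
  Nat.sInf_le h

/-- **Levels are monotone along covering maps** `Y' → Y` (surjective, equivariant). [cite: MochizukiEtTh2009, Def 3.3 (i) p.72] -/
theorem lvl_le_of_hom {Y Y' : ConnectedPart (BTemp Grp)} (f : Y' ⟶ Y) : lvl Y ≤ lvl Y' := by
  obtain ⟨y'₀⟩ := BTempConnected.nonempty_of_isConnectedObj Y'.obj Y'.property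
  refine lvl_le fun g hg y => ?_
  obtain ⟨y', rfl⟩ := BTempConnected.surjective_of_isConnectedObj y'₀ Y.property f.hom y
  rw [← BTempConnected.hom_ρ, closure_lvl_fixes Y' g hg y']

/-- **The level structure of the ζ-twisted Kummer–Tate tower** (Def. 3.3 (i)(c)/(ii) for `(K ⋊_χ C) × ℤ_γ`): levels `ℕ`,
normal `Δ_n`, `lvl`; BOTH laws PROVED. [cite: MochizukiEtTh2009, Def 3.3 (i) p.72] -/
def levels : LevelSystem Grp where
  I := ℕ
  closure := closure
  closure_normal := closure_normal
  lvl := lvl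
  closure_lvl_act Y g hg y := closure_lvl_fixes Y g hg y
  closure_lvl_mono f := closure_antitone (lvl_le_of_hom f)

/-- The levels of `levels` are linearly ordered by their closures (input of the transition maps `x ↦ x^{M_j/M_i}` of
the tower to be built over this group). [cite: MochizukiEtTh2009, Def 3.3 (ii) p.73] -/
theorem levels_le_of_closure_le {i j : ℕ} (h : levels.closure j ≤ levels.closure i) : i ≤ j := le_of_closure_le h

/-- The conjugation action of the constant field on the level-`n` Kummer generator IS the cyclotomic character:
`(1, c, 1) · δ_n · (1, c, 1)⁻¹` has level-`n` coordinate `(χ_n(c), 0)` — the twist is NON-TRIVIAL as soon as `c_n ≠ 1`.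
[cite: MochizukiEtTh2009, §1 p.13] -/
theorem conj_delta_coord (c : Cst) (n : ℕ) :
    (((SemidirectProduct.inr c, 1) : Grp) * delta n * ((SemidirectProduct.inr c, 1) : Grp)⁻¹).1.left.toAdd n =
      ((c n : ZMod (M n)), 0) := by
  rw [delta, conj_ofKum, ofKum, SemidirectProduct.left_inl, SemidirectProduct.right_inr, toAdd_act_apply, toAdd_ofAdd,
    Pi.single_eq_same, Units.smul_def, Prod.smul_mk, smul_eq_mul, mul_one, smul_zero]

end TateTowerKummerTwist

end Literature.AnabelianGeometry.EtaleTheta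

end
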